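import Literature.Computability.AlgebraicComplexity.BDI20NisanWidthProofs
import HarnessLib

/-!
# NisanPermanent — the noncommutative ABP width of the ordered permanent is exactly `C(n,⌊n/2⌋)`
(decomposition workshop `decomp-valiant`, lens 6 «restricted-models lifting axis», gen 4: the
DECIDED bottom rung of the commutativity dial of `Theorems.CommutativityDial`; supports
`DecompCycle1.PerNotSmVP`, stmt-ValiantsHypothesis-23661)

Nisan (1991, Thm 1) proved that a homogeneous noncommutative algebraic branching program computing a
degree-`d` word tensor `Ψ` needs width `rank M_a(Ψ)` at layer `a`, `M_a` the partial-coefficient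
matrix (sequential flattening); the tree has this in transfer-matrix form
(`BDI2020.hasNcABPWidthLE_iff_wordTTRank_le`, file `BDI20NisanWidthProofs`). Here we instantiate it
for the ORDERED PERMANENT: its word tensor `perWord n` over the alphabet of rows (position `t` =
column `t`, letter = the row `π t`) is the indicator of the injective words, the flattening
`M_a(perWord n)` has rank EXACTLY `C(n,a)` (`rank_wordFlattening_perWord`: its nonzero rows are the
`C(n,a)` indicator patterns "columns avoid `S`", `|S| = a`, which have pairwise disjoint supports),
hence (`hasNcABPWidthLE_perWord_iff`)

  `perWord n` has a noncommutative ABP of width `≤ w`  iff  `C(n,⌊n/2⌋) ≤ w`.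

So on the bottom rung of the dial COMMUTATIVE ⊋ SYNTACTICALLY MULTILINEAR ⊋ ORDERED (= nc circuits)
⊋ ORDERED ABPs the permanent is exponentially hard AND the bound is tight — a kernel witness that
the nc hardness conjunct `CommutativityDial.PerNotNcVP` has a decided analogue in a regime where
`VP ≠ VNP` is not known (over every field).

## References

* [Nisan1991Noncommutative] N. Nisan, *Lower bounds for non-commutative computation*, STOC 1991,
  Thm 1 and §4 (permanent / determinant: ABP size `∑ₐ C(n,a) = 2ⁿ`).
* [BlaserDorflerIkenmeyer2020] M. Bläser, J. Dörfler, C. Ikenmeyer, CCC 2021, Def 6.1 / Prop 6.6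
  (tree `BDI2020.HasNcABPWidthLE`).
-/

noncomputable section

namespace Summit.ValiantsHypothesis.ValiantsHypothesis.Theorems.NisanPermanent

open Literature.Computability.AlgebraicComplexity

variable (F : Type*) [Field F]

/-! ## §1 The word tensor of the ordered permanent and its row patterns -/

/-- The WORD TENSOR OF THE ORDERED PERMANENT `∑_π X_(π 0,0) ⋯ X_(π (n-1),n-1)` over the alphabet of
rows: the coefficient of the word `w : Fin n → Fin n` (letter `w t` = the row of the variable read
in position/column `t`) is `1` if `w` is injective (a permutation) and `0` otherwise (Nisan 1991 §4).
[cite: Nisan1991Noncommutative, §4] -/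
def perWord (n : ℕ) : (Fin n → Fin n) → F :=
  fun w => if Function.Injective w then 1 else 0

/-- The ROW PATTERN of Nisan's matrix attached to a set `S` of used rows: the indicator of the
injective suffix words `v : Fin b → Fin n` avoiding `S`. [cite: Nisan1991Noncommutative, §4] -/
def rowPattern {n : ℕ} (b : ℕ) (S : Finset (Fin n)) : (Fin b → Fin n) → F :=
  fun v => if Function.Injective v ∧ ∀ t, v t ∉ S then 1 else 0

variable {F}

/-- Entries of Nisan's matrix `M_a(perWord n)`: `1` iff prefix and suffix are injective with
disjoint letters. [cite: Nisan1991Noncommutative, §4] -/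
theorem wordFlattening_perWord_apply {n a b : ℕ} (h : a + b = n) (u : Fin a → Fin n)
    (v : Fin b → Fin n) :
    wordFlattening (perWord F n) a b h u v =
      if Function.Injective u ∧ Function.Injective v ∧ ∀ i j, u i ≠ v j then 1 else 0 := by
  rw [wordFlattening_apply, perWord]
  have hc : (Function.Injective fun t => Fin.append u v (Fin.cast h.symm t)) ↔
      Function.Injective (Fin.append u v) :=
    Function.Injective.of_comp_iff' (Fin.append u v) (finCongr h.symm).bijective
  simp only [hc, Fin.append_injective_iff]

/-- The rows of Nisan's matrix: the row of an injective prefix `u` is the pattern of its letter set,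
every other row vanishes. [cite: Nisan1991Noncommutative, §4] -/
theorem wordFlattening_perWord_row {n a b : ℕ} (h : a + b = n) (u : Fin a → Fin n) :
    wordFlattening (perWord F n) a b h u =
      if Function.Injective u then rowPattern F b (Finset.univ.image u) else 0 := by
  ext v
  rw [wordFlattening_perWord_apply]
  by_cases hu : Function.Injective u
  · simp only [hu, true_and, if_true, rowPattern, Finset.mem_image, Finset.mem_univ, not_exists]
    congr 1
    exact propext ⟨fun ⟨hv, huv⟩ => ⟨hv, fun t i => huv i t⟩, fun ⟨hv, huv⟩ => ⟨hv, fun i t => huv t i⟩⟩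
  · simp [hu]

/-! ## §2 The row patterns are attained, nonzero and have disjoint supports -/

/-- The increasing enumeration of `S`, an injective prefix with letter set `S`. [folklore] -/
theorem image_orderEmbOfFin {n a : ℕ} (S : Finset (Fin n)) (hS : S.card = a) :
    Finset.univ.image (fun i : Fin a => S.orderEmbOfFin hS i) = S := by
  apply Finset.coe_injective
  rw [Finset.coe_image, Finset.coe_univ, Set.image_univ]
  exact Finset.range_orderEmbOfFin S hS

/-- Every pattern `rowPattern S`, `|S| = a`, is a row of Nisan's matrix. [cite: Nisan1991Noncommutative, §4] -/
theorem rowPattern_mem_range {n a b : ℕ} (h : a + b = n) (S : Finset (Fin n)) (hS : S.card = a) :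
    rowPattern F b S ∈ Set.range (wordFlattening (perWord F n) a b h).row := by
  refine ⟨fun i => S.orderEmbOfFin hS i, ?_⟩
  rw [Matrix.row, wordFlattening_perWord_row, if_pos (S.orderEmbOfFin hS).injective,
    image_orderEmbOfFin]

/-- The complement enumeration: an injective suffix avoiding exactly `S`. [folklore] -/
theorem card_compl_eq {n a b : ℕ} (h : a + b = n) (S : Finset (Fin n)) (hS : S.card = a) :
    Sᶜ.card = b := by
  rw [Finset.card_compl, Fintype.card_fin, hS]
  omega

/-- `rowPattern S` takes the value `1` at the increasing enumeration of `Sᶜ`. [folklore] -/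
theorem rowPattern_self {n a b : ℕ} (h : a + b = n) (S : Finset (Fin n)) (hS : S.card = a) :
    rowPattern F b S (fun t => Sᶜ.orderEmbOfFin (card_compl_eq h S hS) t) = 1 := by
  rw [rowPattern, if_pos]
  refine ⟨(Sᶜ.orderEmbOfFin _).injective, fun t => ?_⟩
  exact Finset.mem_compl.mp (Finset.orderEmbOfFin_mem _ _ t)

/-- `rowPattern S'` vanishes at the enumeration of `Sᶜ` for `S' ≠ S` of the same size (disjoint
supports). [folklore] -/
theorem rowPattern_other {n a b : ℕ} (h : a + b = n) (S S' : Finset (Fin n)) (hS : S.card = a)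
    (hS' : S'.card = a) (hne : S' ≠ S) :
    rowPattern F b S' (fun t => Sᶜ.orderEmbOfFin (card_compl_eq h S hS) t) = 0 := by
  rw [rowPattern, if_neg]
  rintro ⟨-, hav⟩
  apply hne
  refine Finset.eq_of_subset_of_card_le (fun x hx => ?_) (by rw [hS, hS'])
  by_contra hxS
  obtain ⟨t, ht⟩ : x ∈ Set.range (Sᶜ.orderEmbOfFin (card_compl_eq h S hS)) := by
    rw [Finset.range_orderEmbOfFin]; exact Finset.mem_coe.mpr (Finset.mem_compl.mpr hxS)
  exact hav t (ht ▸ hx)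

/-- The patterns `rowPattern S`, `|S| = a`, are linearly independent. [cite: Nisan1991Noncommutative, §4] -/
theorem linearIndependent_rowPattern {n a b : ℕ} (h : a + b = n) :
    LinearIndependent F fun S : {S : Finset (Fin n) // S.card = a} => rowPattern F b S.1 := by
  rw [linearIndependent_iff']
  intro s g hsum S hS
  have key := congr_fun hsum (fun t => S.1ᶜ.orderEmbOfFin (card_compl_eq h S.1 S.2) t)
  rw [Finset.sum_apply, Pi.zero_apply,
    Finset.sum_eq_single S (fun S' _ hS'S => ?_) (fun hS' => absurd hS hS')] at key
  · simpa [rowPattern_self h S.1 S.2] using key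
  · have hne : S'.1 ≠ S.1 := fun e => hS'S (Subtype.ext e)
    simp [rowPattern_other h S.1 S'.1 S.2 S'.2 hne]

/-! ## §3 Rank of Nisan's matrix and the width of the ordered permanent -/

/-- The row space of Nisan's matrix is spanned by the patterns. [cite: Nisan1991Noncommutative, §4] -/
theorem span_range_row_eq {n a b : ℕ} (h : a + b = n) :
    Submodule.span F (Set.range (wordFlattening (perWord F n) a b h).row) =
      Submodule.span F (Set.range fun S : {S : Finset (Fin n) // S.card = a} =>
        rowPattern F b S.1) := by
  apply le_antisymm
  · refine Submodule.span_le.mpr ?_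
    rintro _ ⟨u, rfl⟩
    rw [Matrix.row, wordFlattening_perWord_row]
    by_cases hu : Function.Injective u
    · rw [if_pos hu]
      refine Submodule.subset_span ⟨⟨Finset.univ.image u, ?_⟩, rfl⟩
      rw [Finset.card_image_of_injective _ hu, Finset.card_univ, Fintype.card_fin]
    · rw [if_neg hu]; exact Submodule.zero_mem _
  · refine Submodule.span_le.mpr ?_
    rintro _ ⟨S, rfl⟩
    exact Submodule.subset_span (rowPattern_mem_range h S.1 S.2)

/-- NISAN'S MATRIX OF THE PERMANENT HAS RANK EXACTLY `C(n,a)` at the cut `a | b`.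
[cite: Nisan1991Noncommutative, §4] -/
theorem rank_wordFlattening_perWord {n a b : ℕ} (h : a + b = n) :
    (wordFlattening (perWord F n) a b h).rank = n.choose a := by
  rw [Matrix.rank_eq_finrank_span_row, span_range_row_eq h,
    finrank_span_eq_card (linearIndependent_rowPattern h), Fintype.card_finset_len,
    Fintype.card_fin]

/-- THE DECIDED BOTTOM RUNG OF THE COMMUTATIVITY DIAL (Nisan 1991, tight): the ordered permanent
has a noncommutative algebraic branching program of width `≤ w` iff `C(n,⌊n/2⌋) ≤ w`; in particular
every nc-ABP for it has width `≥ C(n,⌊n/2⌋) ≥ 2ⁿ/(n+1)`, and this is attained.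
[cite: Nisan1991Noncommutative, Thm 1, §4; BlaserDorflerIkenmeyer2020, Prop 12 (arXiv; = CCC 2021 Prop 6.6)] -/
theorem hasNcABPWidthLE_perWord_iff (n w : ℕ) :
    BDI2020.HasNcABPWidthLE w (perWord F n) ↔ n.choose (n / 2) ≤ w := by
  rw [BDI2020.hasNcABPWidthLE_iff_wordTTRank_le, wordTTRank_le_iff]
  constructor
  · intro H
    have := H (n / 2) (n - n / 2) (by omega)
    rwa [rank_wordFlattening_perWord] at this
  · intro hw a b h
    rw [rank_wordFlattening_perWord]
    exact (Nat.choose_le_middle a n).trans hw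

/-- Corollary: the nc-ABP width complexity of the ordered permanent is `C(n,⌊n/2⌋)` on the nose.
[cite: Nisan1991Noncommutative, Thm 1, §4] -/
theorem ncAbpWidth_perWord (n : ℕ) : BDI2020.ncAbpWidth (perWord F n) = n.choose (n / 2) := by
  apply le_antisymm
  · exact BDI2020.ncAbpWidth_le ((hasNcABPWidthLE_perWord_iff n _).mpr le_rfl)
  · exact le_csInf ⟨_, (hasNcABPWidthLE_perWord_iff n _).mpr le_rfl⟩
      fun w hw => (hasNcABPWidthLE_perWord_iff n w).mp hw

end Summit.ValiantsHypothesis.ValiantsHypothesis.Theorems.NisanPermanent
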